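import Literature.MathematicalPhysics.QuantumFieldTheory.Balaban1983to89.B6Prop26GradKLevelV1
import Literature.MathematicalPhysics.QuantumFieldTheory.Balaban1983to89.B6HolderPairGeometryV1
import Literature.MathematicalPhysics.QuantumFieldTheory.Balaban1983to89.B6HolderPairMemberV1
import Literature.MathematicalPhysics.QuantumFieldTheory.Balaban1983to89.B6BlockHolderLipschitzV1
import HarnessLib

/-!
# `Balaban1983to89.B6Prop26PairGKLevelV1` — T. Bałaban, *Propagators and renormalization transformations for lattice gauge theories. II*,
# Commun. Math. Phys. **96** (1984) 223–250 [Balaban1984PropagatorsII], Proposition 2.6 (2.136)–(2.137) p. 247 with [4] (1.109) p. 35: THE PAIR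
# (LIPSCHITZ) MAJORANT OF THE GENUINE `k`-LEVEL `G = Δ_a⁻¹` ITSELF ON THE V1 TORUS — `|(GJ)(x) − (GJ)(x′)| ≤ O(1)·(|x − x′|_∞/Lʲ)·(Lʲη)²·e^{−δ d(y,y′)}|J|`
# for fine bonds `x, x′` of one direction at distance `≤ L^{j(y(x))}`, by TELESCOPING THE (2.136)₂ ENTRY `|(∇GJ)(x)| ≤ O(1)Lʲη e^{−δ₃d}|J|` along a lattice
# staircase (the `k`-level twin of `B6HolderPairMemberV1.holderG_member`; the one-family input (ii) of p21's two-family Hölder member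
# `B9Thm314GFlatV1DivHolder.thm314_Gdiv_holder_flat_V1_of_majorants`)

statement-level skeleton of published theorems with citation tags; proofs where landed; nothing here is a claim about the Yang–Mills mass gap

PDF held: `paper:balaban1984-cmp96-propagators-rt-ii` (journal page = PDF page + 222), p. 247 [PDF 25]: *"|(GJ)(x)|, |(∇GJ)(x)|, |(G∇*J)(x)|, |(ΔGJ)(x)| ≤
O(1)[(Lʲη)², Lʲη, Lʲη, 1] e^{−δ₃d(y,y′)}|J| (2.136) for x ∈ Δ(y), y ∈ Λ_j, supp J ⊂ Δ(y′)"* and *"‖ζ∇GJ‖_α, ‖ζG∇*J‖_α ≤ O(1)(Lʲη)^{1−α}(‖ζ‖^ξ_α + |ζ|)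
e^{−δ₃d(y,y′)}|J|, ξ = L^{−j} (2.137)"*; [4] = *… I*, CMP **95** (1984) p. 35 (1.109): the Hölder quotient over pairs `x, x′` at distance at most the scale.

CITATION HEADER (lean-in-tree rule) — WHAT IS REPRODUCED.  Phase-2 file of the `lit-balaban` typed skeleton (HOME `run/shared/lean/pub/lit-balaban/`), seat
**p21 gen 30** (free-target protocol G.5-34(d), own lane = [B9] Thm 3.14 at `U = 1`; HOME/STATUS TAKING 2026-08-28T00:11Z); SKELETON row **B6.Prop2.6**
(member cells only; head and decls of record r03's).  Print has no separate numbered line for the pair difference of `G` itself (only `∇G`, `G∇*` carry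
the Hölder norm in (2.137)); the estimate below is the one-line consequence of (2.136)₂ by the fundamental theorem of lattice calculus
`(GJ)(x) − (GJ)(x′) = Σ_{steps} η·(∇_μGJ)(z)` along a staircase from `x′` to `x` — the form in which the tree's two-family engine for (2.137)₂ consumes
«a pair majorant of `G[Ω]`» (hypothesis (ii) of `…B9Thm314GFlatV1DivHolder.thm314_Gdiv_holder_flat_V1_of_majorants`).  Contents:
* §1 **`hasMajorant_pairOp_of_grad`** — GENERIC TELESCOPING ON THE `k`-LEVEL V1 TORUS: for ANY fine-bond operator `T` whose forward differences
  `∇^η_ν∘T` (`B6GradLegKLevelV1.DV ν c′ ∘ₗ T`) carry the (2.136)₂-type majorant `A·(L^{j(y)}|c′|⁻¹)·e^{−δ d_T(y,y′)}` for every direction `ν`, and fine bonds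
  `x, x′` of one direction with `|x − x′|_∞ ≤ L^{j(y(x))}` (`M_h = Lᵃ ≥ 8`, `R ≥ 2L²`, `P′ ≥ 4`, all cubes placed — the setting of p22's pair geometry):
  `HasMajorant (P_{x,x′}∘T) (A′·((|x − x′|_∞/L^{j(y(x))})·pref c′ y)·e^{−δ d_T(y,y′)})` with `A′ = (d+1)·L·e^{δ(d+1)(L+2)}·A` — i.e. for `J` supported in
  `B(y′)`: `|(TJ)(x) − (TJ)(x′)| ≤ A′·(|x − x′|_∞/L^{j(y(x))})·(L^{j(y(x))}/c′)²·e^{−δ d_T(y(x),y′)}·|J|`.  THE PROOF: the staircase path lemma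
  `B6BlockHolderLipschitzV1.pseudoDist_le_path` for the pseudo-distance `S(c, c′) = |(TJ)(c, ν_x) − (TJ)(c′, ν_x)|` on fine sites (at most `(d+1)·|x − x′|_∞`
  unit steps, all inside the ball `|x − ·|_∞ ≤ |x − x′|_∞`); one step `c → c + e_μ` costs `|c′|⁻¹·|(∇^η_μ TJ)(c, ν_x)|` (`DV_apply`), bounded by the
  (2.136)₂ majorant AT THE BLOCK OF THE STEP, which is moved to the block `y(x)` by p22's `B6HolderPairGeometryV1.pair_levels` (`L^{j(y(z))} ≤ L·L^{j(y(x))}`)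
  and `pair_distT_le` (`d_T(y(x), y(z)) ≤ (d+1)(L+2)`, so `e^{−δd_T(y(z),y′)} ≤ e^{δ(d+1)(L+2)}e^{−δd_T(y(x),y′)}` by the triangle inequality (2.54)) at the cube
  carrying `x` (`Σ_□ h_□(x)² = 1`);
* §2 **`pairG_kLevel`** — THE PAIR MAJORANT OF THE GENUINE `k`-LEVEL `G` IN CENSUS SHAPE: `∃ δ > 0, A ≥ 0, M₂ > 0` (on `d, L, b₀, b₁`) such that on every
  admissible V1 torus (`k ≥ 2`, `M_h = Lᵃ ≥ 8`, `R ≥ 2L²`, `P′ ≥ 5`, `L ≥ 5`, cubes placed, `M₂ ≤ L·M_h`), for every `c′ ≠ 0`, positive weights in the global band,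
  fine bonds `x, x′` of one direction with `|x − x′|_∞ ≤ L^{j(y(x))}`:
  `HasMajorant (P_{x,x′} ∘ G) (A·((|x − x′|_∞/L^{j(y(x))})·pref c′ y)·e^{−δ d_T(y,y′)})` — §1 fed with p38's (2.136)₂ at `k` levels
  `B6Prop26GradKLevelV1.prop26_2136_grad_kLevel_unconditional` (`σ := σ₁`, `α := ½`, rate `δ = delta3 ½ (2σ₁) = σ₁/2`).
All theorems, proved, 0 sorry, no definition, no `def … : Prop`; standard axioms; imports BY NAME, restating nothing (two private copies of p38's one-line
helpers `supDist_self'`, `exists_hB_ne_zero` of `…B6Prop26HolderDivCensusV1`, which are private there).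

HONEST SCOPE / DIVERGENCES.  (1) Print states no pair bound for `G` itself; this is the Lipschitz consequence of the printed (2.136)₂, with OUR constant
`(d+1)·L·e^{δ(d+1)(L+2)}` and the (2.136)₂ rate unchanged; the gain is the full Lipschitz factor `|x − x′|_∞/L^{j}` (exponent 1, hence `≤ t^α` for every
`α ≤ 1` since `t ≤ 1`).  (2) The pair is read at the output block `y(x)` of its first point, as in the tree's (2.137) files; `|x − x′|_∞ ≤ L^{j(y(x))}` (print's
«x, x′ ∈ Δ̃(y)»).  (3) Setting as in the imported files: V1 torus, `k ≥ 2` in §2 (`k ≤ m + K` in §1), `M_h = Lᵃ ≥ 8`, `R ≥ 2L²`, `P′ ≥ 5` (§1: `≥ 4`), odd `L ≥ 5`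
in §2, cubes placed, global band; constants on `d, L, b₀, b₁`, not optimised.  Integer tori, lattice units (`η = |c′|⁻¹`); nothing on d = 4 specifically or
the continuum; NOT summit progress.  Unit `lit-balaban-p21` (gen 30), 2026-08-28.
-/

noncomputable section

open scoped BigOperators
open Finset

namespace Literature.MathematicalPhysics.QuantumFieldTheory.Balaban1983to89.B6Prop26PairGKLevelV1

open LatticeFieldCalculus (supDist)
open B4Sect5Torus (IsPseudoDist)
open B6MultiLevelBoxOperator (N0)
open B6MultiLevelTorusOperator (TDomains)
open B6Cover236MultiLevelBlocks (cubes)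
open B6Geom246MultiLevelBox (bset)
open B6Geom246MultiLevelTorus (geomT triangle_refl_nonneg_T)
open B8Ineq192MultiLevelTorus (geomT_len)
open B6RandomWalk (HasMajorant hasMajorant_mono BlockSupp delta3 delta3_pos)
open B6Ineq2133TwoScaleV1 (onFun)
open B6GlobalChartV1 (PV domT blkV1)
open B6SectAOperatorsV1 (BondIdx)
open B6SectAVectorModelV1 (GE)
open B6Partition118KLevelTorusCentral (one_le_of_four_le)
open B6Prop26KLevelSkeletonV1 (hB sum_hB_sq pref pref_nonneg)
open B6CubeWindowV1 (j0 Placed GlobalBand one_le_of_eight_le four_le_of_five_le)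
open B6HolderPairMemberV1 (pairOp hasMajorant_pairOp_mul)
open B6HolderPairGeometryV1 (pair_levels pair_distT_le)
open B6GradLegKLevelV1 (DV DV_apply)
open B6BlockHolderLipschitzV1 (pseudoDist_le_path)
open B6Prop26GradKLevelV1 (prop26_2136_grad_kLevel_unconditional)

variable {d ℓ : ℕ} {hd : 1 ≤ d + 1} {hL : Odd (ℓ + 1) ∧ 1 < ℓ + 1} {m K : ℕ} {Mh k R : ℕ} {P' : Fin (d + 1) → ℕ}

/-! ## §0  Two one-line helpers (private copies of p38's) -/

/-- `|z − z|_∞ = 0`. [folklore] -/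
private theorem supDist_self' (z : Site (PV d ℓ m K hd hL) 0) : supDist z z = 0 := by
  unfold supDist
  simp

/-- every fine bond is ACTIVE for some cube: `Σ_□ h_□(x)² = 1` forces `h_□(x) ≠ 0` for some `□`. [cite: Balaban1984PropagatorsII, (2.36) p.229] -/
private theorem exists_hB_ne_zero (hN : ∀ μ, N0 ℓ Mh k P' μ = (PV d ℓ m K hd hL).sitesPerDir 0) (D : TDomains d ℓ Mh k P' R)
    (hMh1 : 1 ≤ Mh) (hP : ∀ μ, 1 ≤ P' μ) (x : PBond (PV d ℓ m K hd hL) 0) : ∃ c : ↥(cubes D.toDomains), hB hN D c x ≠ 0 := by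
  by_contra hno
  simp only [not_exists, ne_eq, not_not] at hno
  have h := sum_hB_sq hN D hMh1 hP x
  have h0 : ∑ c ∈ Finset.univ, hB hN D c x ^ 2 = 0 := Finset.sum_eq_zero fun c _ => by rw [hno c]; ring
  linarith

/-- the prefactor `pref c′ y = (L^{j(y)}/c′)²` written with the printed length `len y = L^{j(y)}` and `|c′|⁻¹`.
[cite: Balaban1984PropagatorsII, (2.136) p.247, bookkeeping] -/
private theorem pref_eq_len_sq {D : TDomains d ℓ Mh k P' R} (cf : ℝ) (y : (geomT D).Site) :
    pref cf y = ((geomT D).len y * |cf|⁻¹) ^ 2 := by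
  have hcast : (((ℓ + 1 : ℕ) : ℝ)) = (ℓ : ℝ) + 1 := by push_cast; ring
  rw [pref, geomT_len, mul_one, hcast, div_eq_mul_inv, mul_pow, mul_pow, inv_pow, inv_pow, sq_abs]

/-! ## §1  Generic telescoping: (2.136)₂-type majorants of `∇_ν∘T` give the pair (Lipschitz) majorant of `T` -/

section Telescoping

/-- **THE PAIR MAJORANT FROM THE GRADIENT MAJORANTS, BY TELESCOPING ALONG A LATTICE STAIRCASE** (`k`-level V1 torus; `M_h = Lᵃ ≥ 8`, `R ≥ 2L²`,
`P′ ≥ 4`, cubes placed): if every forward difference `∇^η_ν∘T` has the majorant `A·(L^{j(y)}·|c′|⁻¹)·e^{−δ d_T(y,y′)}` (`A, δ ≥ 0`), then for fine bonds `x, x′`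
of one direction with `|x − x′|_∞ ≤ L^{j(y(x))}` the pair-difference operator `P_{x,x′}∘T` has the majorant
`((d+1)·L·e^{δ(d+1)(L+2)}·A)·((|x − x′|_∞/L^{j(y(x))})·pref c′ y)·e^{−δ d_T(y,y′)}`, i.e. `|(TJ)(x) − (TJ)(x′)| ≤ A′·(|x − x′|_∞/L^{j})·(Lʲ/c′)²·e^{−δd_T(y(x),y′)}|J|`
for `supp J ⊂ B(y′)`.
[cite: Balaban1984PropagatorsII, Prop. 2.6 (2.136) p.247 (second entry), (2.137) p.247 (x, x′ ∈ Δ̃(y)), (2.54) p.232; Balaban1984PropagatorsI, (1.109) p.35, (1.7) p.18] -/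
theorem hasMajorant_pairOp_of_grad
    (hN : ∀ μ, N0 ℓ Mh k P' μ = (PV d ℓ m K hd hL).sitesPerDir 0) (D : TDomains d ℓ Mh k P' R) (hk : k ≤ m + K)
    {a : ℕ} (hMha : Mh = (ℓ + 1) ^ a) (hM8 : 8 ≤ Mh) (hR2 : 2 * (ℓ + 1) ^ 2 ≤ R) (hP4 : ∀ μ, 4 ≤ P' μ)
    (hpl : ∀ c : ↥(cubes D.toDomains), Placed ℓ k P' c.1)
    {T : Module.End ℝ (PBond (PV d ℓ m K hd hL) 0 → ℝ)} {cf A δ : ℝ} (hcf : cf ≠ 0) (hA : 0 ≤ A) (hδ : 0 ≤ δ)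
    (hD : ∀ ν : Fin (d + 1), HasMajorant (g := geomT D) (blkV1 hN D) (DV ν cf ∘ₗ T)
      (fun y y' => A * ((geomT D).len y * |cf|⁻¹) * Real.exp (-(δ * (geomT D).dist y y'))))
    (x x' : PBond (PV d ℓ m K hd hL) 0) (hdir : x.dir = x'.dir) (hs : supDist x.src x'.src ≤ (ℓ + 1) ^ (blkV1 hN D x).1.1) :
    HasMajorant (g := geomT D) (blkV1 hN D) (pairOp x x' ∘ₗ T)
      (fun y y' => (((d : ℝ) + 1) * ((ℓ : ℝ) + 1) * Real.exp (δ * (((d : ℝ) + 1) * (((ℓ : ℝ) + 1) + 1))) * A) *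
        ((((supDist x.src x'.src : ℕ) : ℝ) / (((ℓ + 1 : ℕ) : ℝ)) ^ (blkV1 hN D x).1.1) * pref cf y) *
        Real.exp (-(δ * (geomT D).dist y y'))) := by
  have hMh1 : 1 ≤ Mh := one_le_of_eight_le hM8
  have hP : ∀ μ, 1 ≤ P' μ := one_le_of_four_le hP4
  obtain ⟨htri, -, hdnn⟩ := triangle_refl_nonneg_T D hMh1 hP
  have hL1 : (1 : ℝ) ≤ (ℓ : ℝ) + 1 := by linarith [(Nat.cast_nonneg ℓ : (0 : ℝ) ≤ ℓ)]
  have hcast : (((ℓ + 1 : ℕ) : ℝ)) = (ℓ : ℝ) + 1 := by push_cast; ring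
  have habs : 0 < |cf| := abs_pos.2 hcf
  set r₀ : ℝ := ((d : ℝ) + 1) * (((ℓ : ℝ) + 1) + 1) with hr₀
  -- the cube carrying `x`; the level of `y(x)` against `j₀(□)`
  obtain ⟨c, hc⟩ := exists_hB_ne_zero hN D hMh1 hP x
  have hlevx := (pair_levels hN D hk (hMh1 := hMh1) (hP4 := hP4) hMha c hM8 hR2 (hpl c) x.dir (x := x) (x' := x) (Or.inl hc)
    (by rw [supDist_self']; exact Nat.zero_le _)).1
  -- notation
  obtain ⟨ρ, hρ⟩ : ∃ s : ℕ, supDist x.src x'.src = s := ⟨_, rfl⟩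
  set yx : (geomT D).Site := blkV1 hN D x with hyx
  set Lx : ℝ := (geomT D).len yx with hLx
  have hLx0 : 0 < Lx := by rw [hLx, geomT_len]; positivity
  have hLxeq : Lx = ((ℓ : ℝ) + 1) ^ yx.1.1 := by rw [hLx, geomT_len, mul_one]
  -- the majorant is non-negative
  have hK0 : ∀ y y' : (geomT D).Site, 0 ≤ (((d : ℝ) + 1) * ((ℓ : ℝ) + 1) * Real.exp (δ * r₀) * A) *
      ((((ρ : ℕ) : ℝ) / (((ℓ + 1 : ℕ) : ℝ)) ^ yx.1.1) * pref cf y) * Real.exp (-(δ * (geomT D).dist y y')) := fun y y' =>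
    mul_nonneg (mul_nonneg (by positivity) (mul_nonneg (by positivity) (pref_nonneg cf y))) (Real.exp_nonneg _)
  rw [hρ, ← Module.End.mul_eq_comp]
  refine hasMajorant_pairOp_mul _ x x' hK0 fun y' μ B hμ => ?_
  have hB0 : 0 ≤ B := hμ.nonneg
  -- the pseudo-distance `S(c, c′) = |(Tμ)(c, ν_x) − (Tμ)(c′, ν_x)|` on fine sites
  set F : PBond (PV d ℓ m K hd hL) 0 → ℝ := T μ with hF
  set S : Site (PV d ℓ m K hd hL) 0 → Site (PV d ℓ m K hd hL) 0 → ℝ := fun p q => |F ⟨p, x.dir⟩ - F ⟨q, x.dir⟩| with hSdef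
  have hS : IsPseudoDist S :=
    { symm := fun p q => abs_sub_comm _ _
      zero := fun p => by simp [hSdef]
      triangle := fun p q r => abs_sub_le _ _ _ }
  -- the cost of one step inside the ball `|x − ·|_∞ ≤ |x − x′|_∞`
  set Ex : ℝ := Real.exp (-(δ * (geomT D).dist yx y')) with hEx
  set Bstep : ℝ := |cf|⁻¹ * (A * (((ℓ : ℝ) + 1) * (Lx * |cf|⁻¹)) * (Real.exp (δ * r₀) * Ex) * B) with hBstep
  have hBstep0 : 0 ≤ Bstep := by positivity
  have hstep : ∀ (p : Site (PV d ℓ m K hd hL) 0) (μ' : Fin (PV d ℓ m K hd hL).d),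
      supDist x.src p ≤ supDist x.src x'.src → S p (p.shift μ') ≤ Bstep := by
    intro p μ' hp
    set z : PBond (PV d ℓ m K hd hL) 0 := ⟨p, x.dir⟩ with hz
    -- the forward difference at `z`
    have hDV : (DV μ' cf ∘ₗ T) μ z = cf * (F ⟨p.shift μ', x.dir⟩ - F z) := by
      rw [LinearMap.comp_apply, DV_apply]
    have hb : |(DV μ' cf ∘ₗ T) μ z| ≤ A * ((geomT D).len (blkV1 hN D z) * |cf|⁻¹) * Real.exp (-(δ * (geomT D).dist (blkV1 hN D z) y')) * B :=
      hD μ' y' μ B hμ z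
    -- the geometry of the pair `(x, z)` at the cube carrying `x`
    have hdist : supDist x.src z.src ≤ (ℓ + 1) ^ (j0 hMh1 hP4 c + 1) :=
      hp.trans (hs.trans (Nat.pow_le_pow_right (Nat.succ_pos ℓ) hlevx.2))
    have hG1 := (pair_levels hN D hk (hMh1 := hMh1) (hP4 := hP4) hMha c hM8 hR2 (hpl c) μ' (x := x) (x' := z) (Or.inl hc) hdist).2
    have hG2 := pair_distT_le hN D hk (hMh1 := hMh1) (hP4 := hP4) hMha c hM8 hR2 (hpl c) μ' (x := x) (x' := z) (Or.inl hc) hdist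
    have hjj : (blkV1 hN D z).1.1 ≤ yx.1.1 + 1 := by omega
    have hlen : (geomT D).len (blkV1 hN D z) * |cf|⁻¹ ≤ ((ℓ : ℝ) + 1) * (Lx * |cf|⁻¹) := by
      rw [geomT_len, mul_one, hLxeq, ← mul_assoc, ← pow_succ']
      exact mul_le_mul_of_nonneg_right (pow_le_pow_right₀ hL1 hjj) (inv_nonneg.2 (abs_nonneg _))
    have hexp : Real.exp (-(δ * (geomT D).dist (blkV1 hN D z) y')) ≤ Real.exp (δ * r₀) * Ex := by
      rw [hEx, ← Real.exp_add]
      refine Real.exp_le_exp.2 ?_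
      have h := (htri yx (blkV1 hN D z) y').trans (add_le_add hG2 le_rfl)
      have h' := mul_le_mul_of_nonneg_left h hδ
      linarith
    have hb' : |(DV μ' cf ∘ₗ T) μ z| ≤ A * (((ℓ : ℝ) + 1) * (Lx * |cf|⁻¹)) * (Real.exp (δ * r₀) * Ex) * B := by
      refine hb.trans ?_
      have hl0 : 0 ≤ (geomT D).len (blkV1 hN D z) * |cf|⁻¹ := by
        have := hlen; rw [geomT_len]; positivity
      gcongr
    -- one step costs `|c′|⁻¹·|(∇_μ′ Tμ)(z)|`
    have hSz : S p (p.shift μ') = |cf|⁻¹ * |(DV μ' cf ∘ₗ T) μ z| := by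
      rw [hDV, abs_mul, ← mul_assoc, inv_mul_cancel₀ habs.ne', one_mul]
      exact abs_sub_comm _ _
    rw [hSz, hBstep]
    exact mul_le_mul_of_nonneg_left hb' (inv_nonneg.2 (abs_nonneg _))
  -- the staircase
  have hpath := pseudoDist_le_path hS x.src x'.src hBstep0 hstep
  have hxx : |F x - F x'| = S x.src x'.src := by
    rw [hSdef]
    cases x with
    | mk xs xdir =>
      cases x' with
      | mk xs' xdir' =>
        simp only at hdir
        subst hdir
        rfl
  have hPd : ((PV d ℓ m K hd hL).d : ℝ) = (d : ℝ) + 1 := by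
    show (((d + 1 : ℕ)) : ℝ) = (d : ℝ) + 1
    push_cast; ring
  rw [hρ] at hpath
  show |F x - F x'| ≤ _
  rw [hxx]
  refine hpath.trans (le_of_eq ?_)
  -- bookkeeping of the constant
  have hpx : (0 : ℝ) < (((ℓ + 1 : ℕ) : ℝ)) ^ yx.1.1 := by positivity
  have hprefx : pref cf yx = Lx ^ 2 * (|cf|⁻¹) ^ 2 := by rw [pref_eq_len_sq, mul_pow]
  have hLx' : (((ℓ + 1 : ℕ) : ℝ)) ^ yx.1.1 = Lx := by rw [hLxeq, hcast]
  rw [hPd, hBstep, hprefx, hLx']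
  field_simp

end Telescoping

/-! ## §2  The pair majorant of the genuine `k`-level `G`, census shape -/

section Genuine

open Classical in
/-- **THE PAIR (LIPSCHITZ) MAJORANT OF THE GENUINE `k`-LEVEL `G = Δ_a⁻¹` ON THE V1 TORUS, CENSUS SHAPE**: for every weight band `[b₀, b₁]` there are
`δ > 0`, `A ≥ 0`, `M₂ > 0` (on `d, L, b₀, b₁`) such that on every admissible V1 torus (`k ≥ 2`, `M_h = Lᵃ ≥ 8`, `R ≥ 2L²`, `P′ ≥ 5`, `L ≥ 5`, all cubes
placed, `M₂ ≤ L·M_h`), for every `c′ ≠ 0`, positive weights in the global band and fine bonds `x, x′` of one direction with `|x − x′|_∞ ≤ L^{j(y(x))}`: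
`HasMajorant (P_{x,x′} ∘ G) (A·((|x − x′|_∞/L^{j(y(x))})·pref c′ y)·e^{−δ d_T(y,y′)})`, i.e. `|(GJ)(x) − (GJ)(x′)| ≤ A·(|x − x′|_∞/L^{j})·(Lʲ/c′)²·e^{−δd_T(y(x),y′)}|J|`
for `supp J ⊂ B(y′)` — §1 fed with the (2.136)₂ entry at `k` levels `B6Prop26GradKLevelV1.prop26_2136_grad_kLevel_unconditional` (`σ := σ₁`, `α := ½`).
[cite: Balaban1984PropagatorsII, Prop. 2.6 (2.136) p.247 (second entry), (2.137) p.247, (2.141) p.247; Balaban1984PropagatorsI, (1.109) p.35] -/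
theorem pairG_kLevel (d ℓ : ℕ) (hd : 1 ≤ d + 1) (hL : Odd (ℓ + 1) ∧ 1 < ℓ + 1) {b₀ b₁ : ℝ} (hb₀ : 0 < b₀) (hb₁ : b₀ ≤ b₁) :
    ∃ δ A M₂ : ℝ, 0 < δ ∧ 0 ≤ A ∧ 0 < M₂ ∧
      ∀ (m K : ℕ) {Mh k R : ℕ} {P' : Fin (d + 1) → ℕ}
        (hN : ∀ μ, N0 ℓ Mh k P' μ = (PV d ℓ m K hd hL).sitesPerDir 0) (D : TDomains d ℓ Mh k P' R) (hk : k ≤ m + K) (_ : 2 ≤ k)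
        {a : ℕ} (_ : Mh = (ℓ + 1) ^ a) (_ : 8 ≤ Mh) (_ : 2 * (ℓ + 1) ^ 2 ≤ R) (_ : ∀ μ, 5 ≤ P' μ) (_ : 4 ≤ ℓ)
        (_ : ∀ c : ↥(cubes D.toDomains), Placed ℓ k P' c.1) (_ : M₂ ≤ ((ℓ : ℝ) + 1) * Mh)
        {cf : ℝ} (hcf : cf ≠ 0) {w : BondIdx (domT hN D hk) → ℝ} (hw : ∀ i, 0 < w i) (_ : GlobalBand b₀ b₁ cf w)
        (x x' : PBond (PV d ℓ m K hd hL) 0), x.dir = x'.dir → supDist x.src x'.src ≤ (ℓ + 1) ^ (blkV1 hN D x).1.1 →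
        HasMajorant (g := geomT D) (blkV1 hN D) (pairOp x x' ∘ₗ onFun (GE (domT hN D hk) hcf hw))
          (fun y y' => A * ((((supDist x.src x'.src : ℕ) : ℝ) / (((ℓ + 1 : ℕ) : ℝ)) ^ (blkV1 hN D x).1.1) * pref cf y) *
            Real.exp (-(δ * (geomT D).dist y y'))) := by
  obtain ⟨σ₁, hσ₁, h⟩ := prop26_2136_grad_kLevel_unconditional d ℓ hd hL hb₀ hb₁
  obtain ⟨A, M₂, hA, hM₂, h2⟩ := h σ₁ hσ₁ le_rfl (1 / 2) (by norm_num) (by norm_num)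
  have hδ : 0 < delta3 (1 / 2) (2 * σ₁) := delta3_pos (by norm_num) (by linarith)
  refine ⟨delta3 (1 / 2) (2 * σ₁),
    ((d : ℝ) + 1) * ((ℓ : ℝ) + 1) * Real.exp (delta3 (1 / 2) (2 * σ₁) * (((d : ℝ) + 1) * (((ℓ : ℝ) + 1) + 1))) * A, M₂, hδ, by positivity, hM₂, ?_⟩
  intro m K Mh k R P' hN D hk hk2 a hMha hM8 hR2 hP5 hℓ hpl hM cf hcf w hw hwb x x' hdir hs
  have hgrad := (h2 m K hN D hk hk2 hMha hM8 hR2 hP5 hℓ hpl hM hcf hw hwb).2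
  exact hasMajorant_pairOp_of_grad hN D hk hMha hM8 hR2 (four_le_of_five_le hP5) hpl hcf hA hδ.le hgrad x x' hdir hs

end Genuine

end Literature.MathematicalPhysics.QuantumFieldTheory.Balaban1983to89.B6Prop26PairGKLevelV1

end
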